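import Literature.AlgebraicGeometry.Resolution.SeparatingBlowup
import Literature.AlgebraicGeometry.Resolution.BlowupsIntegral
import Literature.AlgebraicGeometry.Resolution.BlowupsExistence
import Literature.AlgebraicGeometry.Resolution.BlowupsProofs
import Literature.AlgebraicGeometry.Resolution.PrincipalizationToResolution
import Literature.AlgebraicGeometry.Resolution.RegularLocalRingsProofs
import Literature.AlgebraicGeometry.Resolution.QuasiExcellentSchemes
import Mathlib.AlgebraicGeometry.Noetherian
import HarnessLib

/-!
# Cossart–Piltant 2008, Thm. 2.1, proof — the first reduction AS PRINTED: separating an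
irreducible component by one blowing up

Topic: `Literature/AlgebraicGeometry/CossartPiltant200819`. Companion of `Thm21Assembly2008.lean`
(the assembly of [CP-I] Thm. 2.1 = `CP2008.ResolutionAffineThreefolds`), documenting the ONE step
of the printed proof which that assembly replaces by a different device.

V. Cossart, O. Piltant, *Resolution of singularities of threefolds in positive characteristic.
I*, J. Algebra 320 (2008) 1051–1082, proof of Thm. 2.1 (HAL p. 3, lines 1–4 of the proof):

  "Let `Z₁, …, Z_s` be the distinct irreducible components of `Z`. If `s ≥ 2`, let
  `η : Z' → Z` be the blowing up along the scheme theoretic intersection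
  `Z₁ ∩ (Z₂ ∪ ⋯ ∪ Z_s)`. Note that `η` induces an isomorphism away from the singular locus of
  `Z` and that the strict transform of `Z₁` is a connected component of `Z'`. By induction on
  `s`, we reduce to the case when `Z` is irreducible."

The tree's assembly (`CP2008.exists_isResolution_regularLocus_spec_of_resolutionOfAffineModels`)
performs the induction on `s` with the closed cover `Z = Z₁ ∪ (Z₂ ∪ ⋯ ∪ Z_s)` and the gluing
theorem `Resolution.exists_isResolution_regularLocus_of_irreducibleComponents` (Cossart–Piltant
2019, proof of Prop. 4.6, Step 1: "there is a finite birational morphism `∐ᵢ 𝒳ᵢ → 𝒳`, isomorphic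
above `Reg 𝒳`") instead of the blowing up `η`. This module proves the two printed claims about
`η` themselves, for an arbitrary reduced locally Noetherian scheme `Z`, from the tree's rendering
of Stacks 080P ("separate irreducible components by blowing up", `SeparatingBlowup.lean`) and of
Stacks 02ND / 02OS (`BlowupsIntegral.lean`, `Blowups.lean`). With `𝓘₁ = 𝓘(Z₁)` and
`𝓘_W = 𝓘(W)`, `W = Z₂ ∪ ⋯ ∪ Z_s`, the vanishing (reduced) ideal sheaves, the scheme theoretic
intersection `Z₁ ∩ W` is the closed subscheme of `𝓘₁ + 𝓘_W`, and `𝓘₁ 𝓘_W = 0` because `Z` is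
reduced and `Z₁ ∪ W = Z` (`vanishingIdeal_mul_vanishingIdeal_eq_bot`). For ANY blowing up
`η : Z' → Z` of `𝓘₁ + 𝓘_W` (`Resolution.IsBlowup`, the universal property):

* `thm21_blowup_isIso_of_disjoint`, `inter_subset_compl_regularLocus`,
  `thm21_blowup_isIso_of_subset_regularLocus` — **"`η` induces an isomorphism away from the
  singular locus of `Z`"**: `η` is an isomorphism over every open `U` missing `Z₁ ∩ W`, and
  `Z₁ ∩ W ⊆ Sing Z` (a point on two distinct irreducible components has a local ring which is not
  a domain, hence not regular — Matsumura Thm. 14.3);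
* `dense_compl_inter_of_mem_irreducibleComponents`, `thm21_blowup_isBirational` — the centre
  `Z₁ ∩ W` is nowhere dense and **`η` is birational** (`Resolution.IsBirational`: an isomorphism
  over the dense open `Z ∖ (Z₁ ∩ W)`, whose preimage is dense by Stacks 02ND);
* `thm21_blowup_separation` — **`Z'` is the disjoint union of the strict transforms**: there are
  opens `X₁ ⊔ X₂ = Z'`, `X₁ ∩ X₂ = ∅`, with `X₁ = closure η⁻¹(Z₁ ∖ W)` (the strict transform of
  `Z₁`) and `X₂ = closure η⁻¹(W ∖ Z₁)` (the strict transform of `W`); in particular both are open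
  and closed;
* `isIrreducible_strictTransform`, `strictTransform_eq_connectedComponent` — **"the strict
  transform of `Z₁` is a connected component of `Z'`"** when `Z₁` is irreducible and `Z₁ ⊄ W`:
  it is irreducible (the closure of `η⁻¹(Z ∖ W) ≅ Z ∖ W = Z₁ ∖ W`, a non-empty open of `Z₁`),
  open and closed, hence equal to the connected component of each of its points;
* `thm21_first_reduction` — the printed sentence assembled for a reduced Noetherian scheme `Z`
  and one of its irreducible components `Z₁`, with `W` the union of the other components: the
  blowing up exists (`Stacks01OG_holds`), is proper (`stacks02NS_holds`) and birational, is an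
  isomorphism over `Reg Z`, and `Z'` splits as above with `X₁` irreducible and a connected
  component.

What is NOT done here: the induction on `s` through `η` (it would need, in addition, that the
strict transform `X₂` of `W` has at most `s - 1` irreducible components; that a resolution of
`Z'` composed with the proper birational `η` is a resolution of `Z` is
`Resolution.ComponentGluing.Scheme.HasResolution.of_isBirational`, and the isomorphism over
`Reg Z` composes); the tree's assembly reaches the same reduction through the closed cover, see
above — for the affine
statement `CP2008.ResolutionAffineThreefolds` the induction cannot run through `η` anyway, since
`Z'` is no longer affine while the dimension-three input `CP2008.ResolutionOfAffineModels` is.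
Nothing here is used by `Thm21Assembly2008.lean`; the module records the printed device side by
side with the tree's.

## References

* [CP-I] V. Cossart, O. Piltant, J. Algebra 320 (2008) 1051–1082, proof of Thm. 2.1, HAL
  hal-00139124 p. 3. [CossartPiltant2008]
* The Stacks Project, Tag 080P (Divisors, Lemma 31.35.5) — `SeparatingBlowup.lean`; Tag 02ND,
  Tag 02OS — `BlowupsIntegral.lean`, `Blowups.lean`; Tag 01OG (existence of blowing ups) —
  `BlowupsExistence.lean`; Tag 02NS (blowing ups of Noetherian schemes are proper) —
  `BlowupsProofs.lean`. [StacksProject]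
* H. Matsumura, *Commutative Ring Theory*, CUP 1986, Thm. 14.3 (a regular local ring is a
  domain) — `isDomain_of_isRegularLocalRing`. [Matsumura1987]
* V. Cossart, O. Piltant, J. Algebra 529 (2019) 268–535, proof of Prop. 4.6 [arXiv:1412.0868v1
  Prop. 4.4, p. 50], Step 1 — the tree's alternative device. [CossartPiltant2019]
-/

noncomputable section

open CategoryTheory AlgebraicGeometry TopologicalSpace Topology
open Literature.AlgebraicGeometry.Resolution

namespace Literature.AlgebraicGeometry.CossartPiltant200819.CP2008

universe u

variable {Z : Scheme.{u}}

/-! ## The centre: `𝓘(Z₁) + 𝓘(W)` with `𝓘(Z₁) 𝓘(W) = 0` -/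

/-- On a reduced scheme covered by the closed sets `Z₁` and `W`, the vanishing ideal sheaves
multiply to zero: `𝓘(Z₁) 𝓘(W)` has support `Z₁ ∪ W = Z`, and an ideal sheaf with full support on
a reduced scheme vanishes. [cite: StacksProject, Tag 080P (proof)] -/
theorem vanishingIdeal_mul_vanishingIdeal_eq_bot [IsReduced Z] (Z₁ W : Closeds Z)
    (hcov : (Z₁ : Set Z) ∪ W = Set.univ) :
    Scheme.IdealSheafData.vanishingIdeal Z₁ * Scheme.IdealSheafData.vanishingIdeal W = ⊥ := by
  rw [← Scheme.IdealSheafData.support_eq_top_iff, Scheme.IdealSheafData.support_mul]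
  apply SetLike.coe_injective
  simp only [Closeds.coe_sup, Scheme.IdealSheafData.coe_support_vanishingIdeal, Closeds.coe_top]
  exact hcov

/-- The support of the centre `𝓘(Z₁) + 𝓘(W)` is `Z₁ ∩ W`. [folklore] -/
theorem coe_support_vanishingIdeal_sup (Z₁ W : Closeds Z) :
    ((Scheme.IdealSheafData.vanishingIdeal Z₁ ⊔ Scheme.IdealSheafData.vanishingIdeal W).support :
      Set Z) = (Z₁ : Set Z) ∩ W := by
  rw [Scheme.IdealSheafData.support_sup, Closeds.coe_inf,
    Scheme.IdealSheafData.coe_support_vanishingIdeal,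
    Scheme.IdealSheafData.coe_support_vanishingIdeal]

/-- The open complement of the centre of `𝓘(W)` is `Z ∖ W`. [folklore] -/
theorem coe_centreCompl_vanishingIdeal (W : Closeds Z) :
    ((centreCompl (Scheme.IdealSheafData.vanishingIdeal W) : Z.Opens) : Set Z) = (W : Set Z)ᶜ := by
  change ((Scheme.IdealSheafData.vanishingIdeal W).support : Set Z)ᶜ = _
  rw [Scheme.IdealSheafData.coe_support_vanishingIdeal]

/-! ## "`η` induces an isomorphism away from the singular locus of `Z`" -/

/-- A blowing up of `𝓘(Z₁) + 𝓘(W)` is an isomorphism over every open set missing `Z₁ ∩ W`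
(Görtz–Wedhorn Prop. 13.91 (3) / Stacks 02OS, `IsBlowup.isIso_morphismRestrict`).
[cite: CossartPiltant2008, Thm 2.1 (proof, HAL p. 3)] -/
theorem thm21_blowup_isIso_of_disjoint (Z₁ W : Closeds Z) {Z' : Scheme.{u}} {η : Z' ⟶ Z}
    (hη : IsBlowup η
      (Scheme.IdealSheafData.vanishingIdeal Z₁ ⊔ Scheme.IdealSheafData.vanishingIdeal W))
    (U : Z.Opens) (hU : Disjoint (U : Set Z) ((Z₁ : Set Z) ∩ W)) : IsIso (η ∣_ U) :=
  hη.isIso_morphismRestrict (by rwa [coe_support_vanishingIdeal_sup])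

/-- **A point lying on two distinct irreducible components is singular**: if the local ring at
`z` were regular it would be a domain (Matsumura Thm. 14.3), and then `z` lies on a single
irreducible component (`eq_of_mem_irreducibleComponents_of_isDomain_stalk`). Form used in the
printed proof: `Z₁ ∩ (Z₂ ∪ ⋯ ∪ Z_s) ⊆ Sing Z` for an irreducible component `Z₁` and `W` covered
by components other than `Z₁`. [cite: Matsumura1987, Thm. 14.3] -/
theorem inter_subset_compl_regularLocus {Z₁ W : Set Z} (h₁ : Z₁ ∈ irreducibleComponents Z)
    (hW : ∀ z ∈ W, ∃ C ∈ irreducibleComponents Z, C ≠ Z₁ ∧ z ∈ C) :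
    Z₁ ∩ W ⊆ (Scheme.regularLocus Z)ᶜ := by
  rintro z ⟨hz₁, hzW⟩ hreg
  obtain ⟨C, hC, hne, hzC⟩ := hW z hzW
  rw [Scheme.mem_regularLocus] at hreg
  haveI := hreg
  haveI := isDomain_of_isRegularLocalRing (Z.presheaf.stalk z)
  exact hne (eq_of_mem_irreducibleComponents_of_isDomain_stalk z hC h₁ hzC hz₁)

/-- **"`η` induces an isomorphism away from the singular locus of `Z`"** (HAL p. 3): a blowing
up of `Z₁ ∩ W = V(𝓘(Z₁) + 𝓘(W))`, `Z₁` an irreducible component and `W` covered by the other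
components, is an isomorphism over every open subset of `Reg Z`.
[cite: CossartPiltant2008, Thm 2.1 (proof, HAL p. 3)] -/
theorem thm21_blowup_isIso_of_subset_regularLocus (Z₁ W : Closeds Z)
    (h₁ : (Z₁ : Set Z) ∈ irreducibleComponents Z)
    (hW : ∀ z ∈ (W : Set Z), ∃ C ∈ irreducibleComponents Z, C ≠ Z₁ ∧ z ∈ C)
    {Z' : Scheme.{u}} {η : Z' ⟶ Z}
    (hη : IsBlowup η
      (Scheme.IdealSheafData.vanishingIdeal Z₁ ⊔ Scheme.IdealSheafData.vanishingIdeal W))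
    (U : Z.Opens) (hU : (U : Set Z) ⊆ Scheme.regularLocus Z) : IsIso (η ∣_ U) :=
  thm21_blowup_isIso_of_disjoint Z₁ W hη U
    (Set.disjoint_left.mpr fun _ hzU hz => inter_subset_compl_regularLocus h₁ hW hz (hU hzU))

/-- **The centre `Z₁ ∩ W` is nowhere dense**: for `Z₁` an irreducible component and `W` covered
by components other than `Z₁`, the open set `Z ∖ (Z₁ ∩ W)` is dense — a non-empty open subset
of `Z₁ ∩ W` would meet some component `C ≠ Z₁` in a non-empty open subset of `C`, which is dense
in `C`, forcing `C ⊆ Z₁` and `C = Z₁`. [folklore] -/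
theorem dense_compl_inter_of_mem_irreducibleComponents {Z₁ W : Set Z}
    (h₁ : Z₁ ∈ irreducibleComponents Z)
    (hW : ∀ z ∈ W, ∃ C ∈ irreducibleComponents Z, C ≠ Z₁ ∧ z ∈ C) :
    Dense (Z₁ ∩ W)ᶜ := by
  rw [← interior_eq_empty_iff_dense_compl, Set.eq_empty_iff_forall_notMem]
  intro z hz
  obtain ⟨C, hC, hne, hzC⟩ := hW z (interior_subset hz).2
  have hsub : C ⊆ Z₁ :=
    (subset_closure_inter_of_isPreirreducible_of_isOpen hC.1.isPreirreducible isOpen_interior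
      ⟨z, hzC, hz⟩).trans
      ((closure_mono (Set.inter_subset_right.trans
        (interior_subset.trans Set.inter_subset_left))).trans
        (isClosed_of_mem_irreducibleComponents Z₁ h₁).closure_eq.subset)
  exact hne (Set.Subset.antisymm hsub (hC.2 h₁.1 hsub))

/-- **`η` is birational** in the tree's sense (`Resolution.IsBirational`: an isomorphism over a
dense open subset whose preimage is dense): a blowing up of `Z₁ ∩ W = V(𝓘(Z₁) + 𝓘(W))` is an
isomorphism over `Z ∖ (Z₁ ∩ W)` (Stacks 02OS), which is dense
(`dense_compl_inter_of_mem_irreducibleComponents`), and `η⁻¹(Z ∖ (Z₁ ∩ W))` is dense in `Z'`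
(Stacks 02ND, `IsBlowup.dense_preimage_compl`). Together with properness (Stacks 02NS) this is
what makes "a resolution of `Z'` composed with `η` is a resolution of `Z`" available
(`Resolution.ComponentGluing.Scheme.HasResolution.of_isBirational`).
[cite: CossartPiltant2008, Thm 2.1 (proof, HAL p. 3)] -/
theorem thm21_blowup_isBirational (Z₁ W : Closeds Z)
    (h₁ : (Z₁ : Set Z) ∈ irreducibleComponents Z)
    (hW : ∀ z ∈ (W : Set Z), ∃ C ∈ irreducibleComponents Z, C ≠ Z₁ ∧ z ∈ C)
    {Z' : Scheme.{u}} {η : Z' ⟶ Z}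
    (hη : IsBlowup η
      (Scheme.IdealSheafData.vanishingIdeal Z₁ ⊔ Scheme.IdealSheafData.vanishingIdeal W)) :
    IsBirational η := by
  refine ⟨centreCompl
    (Scheme.IdealSheafData.vanishingIdeal Z₁ ⊔ Scheme.IdealSheafData.vanishingIdeal W),
    ?_, hη.dense_preimage_compl, hη.isIso_compl⟩
  change Dense ((Scheme.IdealSheafData.vanishingIdeal Z₁ ⊔
    Scheme.IdealSheafData.vanishingIdeal W).support : Set Z)ᶜ
  rw [coe_support_vanishingIdeal_sup]
  exact dense_compl_inter_of_mem_irreducibleComponents h₁ hW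

/-! ## `Z'` is the disjoint union of the strict transforms of `Z₁` and `W` -/

/-- The vanishing locus `{𝓚 = 0}` of an ideal sheaf lies in its support `V(𝓚)`. [folklore] -/
theorem vanishingOpen_subset_support {X : Scheme.{u}} (K : X.IdealSheafData) :
    ((vanishingOpen K : X.Opens) : Set X) ⊆ (K.support : Set X) := by
  intro x hx
  obtain ⟨W, hxW⟩ := Opens.mem_iSup.mp hx
  rw [SetLike.mem_coe, Scheme.IdealSheafData.mem_support_iff_of_mem (U := W.1) hxW,
    Scheme.mem_zeroLocus_iff]
  intro f hf
  rw [W.2, Submodule.bot_coe, Set.mem_singleton_iff] at hf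
  rw [hf, Scheme.basicOpen_zero]
  exact fun h => h

/-- One side of Stacks 080P for the centre `𝓘(A) + 𝓘(B)`: the open `X_A = {𝓘(A)𝒪_{Z'} = 0}`
contains `η⁻¹(Z ∖ B)`, is contained in `η⁻¹(A)`, its complement is the open
`X_B = {𝓘(B)𝒪_{Z'} = 0}`, and `X_A` is the closure of `η⁻¹(A ∖ B)` — because `η⁻¹(Z ∖ V)` of the
centre `V = A ∩ B` is dense in the blowing up (Stacks 02ND, `IsBlowup.dense_preimage_compl`).
[cite: StacksProject, Tag 080P] -/
theorem coe_vanishingOpen_eq_closure_preimage [IsReduced Z] [IsLocallyNoetherian Z]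
    (A B : Closeds Z) (hcov : (A : Set Z) ∪ B = Set.univ) {Z' : Scheme.{u}} {η : Z' ⟶ Z}
    (hη : IsBlowup η
      (Scheme.IdealSheafData.vanishingIdeal A ⊔ Scheme.IdealSheafData.vanishingIdeal B)) :
    vanishingOpen ((Scheme.IdealSheafData.vanishingIdeal A).comap η) ⊔
        vanishingOpen ((Scheme.IdealSheafData.vanishingIdeal B).comap η) = ⊤ ∧
      vanishingOpen ((Scheme.IdealSheafData.vanishingIdeal A).comap η) ⊓
        vanishingOpen ((Scheme.IdealSheafData.vanishingIdeal B).comap η) = ⊥ ∧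
      ((vanishingOpen ((Scheme.IdealSheafData.vanishingIdeal A).comap η) : Z'.Opens) : Set Z') =
        closure (η.base ⁻¹' ((A : Set Z) \ B)) := by
  set I := Scheme.IdealSheafData.vanishingIdeal B with hI
  set J := Scheme.IdealSheafData.vanishingIdeal A with hJ
  -- finite type (locally Noetherian) and `𝓘 𝓙 = 0` (reduced, `A ∪ B = Z`)
  have hfg : ∀ (K : Z.IdealSheafData) (W : Z.affineOpens), (K.ideal W).FG := fun K W => by
    haveI := IsLocallyNoetherian.component_noetherian W
    exact IsNoetherian.noetherian _
  have hIJ : I * J = ⊥ :=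
    vanishingIdeal_mul_vanishingIdeal_eq_bot B A ((Set.union_comm _ _).trans hcov)
  have hE : IsEffectiveCartier ((I ⊔ J).comap η) := by
    rw [sup_comm]
    exact hη.isEffectiveCartier
  have htop : vanishingOpen (J.comap η) ⊔ vanishingOpen (I.comap η) = ⊤ :=
    vanishingOpen_sup_vanishingOpen_eq_top I J η (hfg I) (hfg J) hIJ hE
  have hbot : vanishingOpen (J.comap η) ⊓ vanishingOpen (I.comap η) = ⊥ :=
    vanishingOpen_inf_vanishingOpen_eq_bot I J η hE
  refine ⟨htop, hbot, ?_⟩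
  -- `η⁻¹(Z ∖ B) ⊆ X_A ⊆ η⁻¹(A)`
  have h₁ : η ⁻¹ᵁ centreCompl I ≤ vanishingOpen (J.comap η) :=
    preimage_centreCompl_le_vanishingOpen I J η hIJ
  have h₂ : ((vanishingOpen (J.comap η) : Z'.Opens) : Set Z') ⊆ η.base ⁻¹' (A : Set Z) := by
    intro x hx
    have hx' := vanishingOpen_subset_support (J.comap η) hx
    rw [SetLike.mem_coe, Scheme.IdealSheafData.support_comap] at hx'
    have hx'' : η.base x ∈ ((J.support : Closeds Z) : Set Z) := hx'
    rwa [hJ, Scheme.IdealSheafData.coe_support_vanishingIdeal] at hx''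
  -- `X_A` is closed: its complement is the open `X_B`
  have hclosed : IsClosed (((vanishingOpen (J.comap η) : Z'.Opens) : Set Z')) := by
    have hc : ((vanishingOpen (J.comap η) : Z'.Opens) : Set Z')ᶜ =
        ((vanishingOpen (I.comap η) : Z'.Opens) : Set Z') := by
      have h1 : ((vanishingOpen (J.comap η) : Z'.Opens) : Set Z') ∪
          ((vanishingOpen (I.comap η) : Z'.Opens) : Set Z') = Set.univ := by
        rw [← Opens.coe_sup, htop, Opens.coe_top]
      have h2 : ((vanishingOpen (J.comap η) : Z'.Opens) : Set Z') ∩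
          ((vanishingOpen (I.comap η) : Z'.Opens) : Set Z') = ∅ := by
        rw [← Opens.coe_inf, hbot, Opens.coe_bot]
      refine Set.Subset.antisymm (fun y hy => ?_) (fun y hyI hyJ => ?_)
      · rcases (Set.eq_univ_iff_forall.mp h1 y) with hyJ | hyI
        · exact (hy hyJ).elim
        · exact hyI
      · exact (Set.eq_empty_iff_forall_notMem.mp h2 y) ⟨hyJ, hyI⟩
    rw [← isOpen_compl_iff, hc]
    exact (vanishingOpen (I.comap η)).2
  refine Set.Subset.antisymm (fun x hx => ?_) (closure_minimal (fun y hy => ?_) hclosed)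
  · -- density of `η⁻¹(Z ∖ (A ∩ B))`: every neighbourhood of `x ∈ X_A` meets `η⁻¹(A ∖ B)`
    rw [mem_closure_iff]
    intro O hO hxO
    have hd := hη.dense_preimage_compl
    obtain ⟨y, ⟨hyO, hyA⟩, hyc⟩ := hd.inter_open_nonempty
      (O ∩ ((vanishingOpen (J.comap η) : Z'.Opens) : Set Z'))
      (hO.inter (vanishingOpen (J.comap η)).2) ⟨x, hxO, hx⟩
    refine ⟨y, hyO, h₂ hyA, fun hyB => ?_⟩
    -- `η y ∉ A ∩ B`
    have hyc' : η.base y ∉ ((J ⊔ I).support : Set Z) := hyc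
    rw [hJ, hI, coe_support_vanishingIdeal_sup] at hyc'
    exact hyc' ⟨h₂ hyA, hyB⟩
  · -- `η⁻¹(A ∖ B) ⊆ η⁻¹(Z ∖ B) ⊆ X_A`
    refine h₁ ?_
    change η.base y ∈ ((centreCompl I : Z.Opens) : Set Z)
    rw [hI, coe_centreCompl_vanishingIdeal]
    exact hy.2

/-- **Cossart–Piltant 2008, proof of Thm. 2.1, the separating blowing up** (HAL p. 3), in the
form of Stacks 080P: let `Z` be a reduced locally Noetherian scheme, `Z₁, W ⊆ Z` closed with
`Z₁ ∪ W = Z`, and `η : Z' → Z` a blowing up of the scheme theoretic intersection `Z₁ ∩ W`, i.e.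
of `𝓘(Z₁) + 𝓘(W)`. Then `Z'` is the disjoint union of two open (hence also closed) subschemes
`X₁ ⊔ X₂ = Z'`, `X₁ ∩ X₂ = ∅`, where `X₁ = closure η⁻¹(Z₁ ∖ W)` is the strict transform of `Z₁`
and `X₂ = closure η⁻¹(W ∖ Z₁)` the strict transform of `W`.
[cite: CossartPiltant2008, Thm 2.1 (proof, HAL p. 3)] -/
theorem thm21_blowup_separation [IsReduced Z] [IsLocallyNoetherian Z] (Z₁ W : Closeds Z)
    (hcov : (Z₁ : Set Z) ∪ W = Set.univ) {Z' : Scheme.{u}} {η : Z' ⟶ Z}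
    (hη : IsBlowup η
      (Scheme.IdealSheafData.vanishingIdeal Z₁ ⊔ Scheme.IdealSheafData.vanishingIdeal W)) :
    ∃ X₁ X₂ : Z'.Opens, X₁ ⊔ X₂ = ⊤ ∧ X₁ ⊓ X₂ = ⊥ ∧
      (X₁ : Set Z') = closure (η.base ⁻¹' ((Z₁ : Set Z) \ W)) ∧
      (X₂ : Set Z') = closure (η.base ⁻¹' ((W : Set Z) \ Z₁)) := by
  obtain ⟨htop, hbot, h₁⟩ := coe_vanishingOpen_eq_closure_preimage Z₁ W hcov hη
  have hη' : IsBlowup η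
      (Scheme.IdealSheafData.vanishingIdeal W ⊔ Scheme.IdealSheafData.vanishingIdeal Z₁) := by
    rw [sup_comm]; exact hη
  obtain ⟨-, -, h₂⟩ :=
    coe_vanishingOpen_eq_closure_preimage W Z₁ ((Set.union_comm _ _).trans hcov) hη'
  exact ⟨_, _, htop, hbot, h₁, h₂⟩

/-! ## "The strict transform of `Z₁` is a connected component of `Z'`" -/

/-- **The strict transform of an irreducible `Z₁ ⊄ W` is irreducible**: it is the closure of
`η⁻¹(Z ∖ W)`, and `η` is an isomorphism over the open `Z ∖ W = Z₁ ∖ W`, a non-empty open subset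
of the irreducible `Z₁`. [cite: CossartPiltant2008, Thm 2.1 (proof, HAL p. 3)] -/
theorem isIrreducible_strictTransform (Z₁ W : Closeds Z) (hcov : (Z₁ : Set Z) ∪ W = Set.univ)
    (hirr : IsIrreducible (Z₁ : Set Z)) (hnot : ¬ (Z₁ : Set Z) ⊆ W)
    {Z' : Scheme.{u}} {η : Z' ⟶ Z}
    (hη : IsBlowup η
      (Scheme.IdealSheafData.vanishingIdeal Z₁ ⊔ Scheme.IdealSheafData.vanishingIdeal W)) :
    IsIrreducible (closure (η.base ⁻¹' ((Z₁ : Set Z) \ W))) := by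
  -- the open `U = Z ∖ W = Z₁ ∖ W`, over which `η` is an isomorphism
  let U : Z.Opens := ⟨(W : Set Z)ᶜ, W.isClosed.isOpen_compl⟩
  have hdiff : (Z₁ : Set Z) \ W = (U : Set Z) := by
    ext x
    refine ⟨fun hx => hx.2, fun hx => ⟨?_, hx⟩⟩
    rcases (Set.eq_univ_iff_forall.mp hcov x) with h' | h'
    · exact h'
    · exact ((show x ∉ (W : Set Z) from hx) h').elim
  haveI : IsIso (η ∣_ U) := thm21_blowup_isIso_of_disjoint Z₁ W hη U
    (Set.disjoint_left.mpr fun _ hzU hz => hzU hz.2)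
  -- `U` is irreducible
  have hUirr : IsIrreducible (U : Set Z) := by
    rw [← hdiff]
    refine ⟨Set.not_subset.mp hnot |>.imp fun z hz => ⟨hz.1, hz.2⟩, ?_⟩
    exact hirr.2.open_subset (hdiff ▸ U.2) Set.sdiff_subset
  haveI : PreirreducibleSpace U := Subtype.preirreducibleSpace hUirr.2
  -- transport along the homeomorphism `η⁻¹(U) ≅ U`
  have hVuniv : IsPreirreducible (Set.univ : Set (η ⁻¹ᵁ U : Z'.Opens)) := by
    have e := (asIso (η ∣_ U)).schemeIsoToHomeo
    have : (Set.univ : Set (η ⁻¹ᵁ U : Z'.Opens)) = e.symm '' Set.univ := by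
      rw [Set.image_univ, e.symm.range_coe]
    rw [this]
    exact (PreirreducibleSpace.isPreirreducible_univ).image _ e.symm.continuous.continuousOn
  have hVirr : IsPreirreducible ((η ⁻¹ᵁ U : Z'.Opens) : Set Z') := by
    have : ((η ⁻¹ᵁ U : Z'.Opens) : Set Z') = (η ⁻¹ᵁ U).ι '' Set.univ := by
      rw [Set.image_univ, Scheme.Opens.range_ι]
    rw [this]
    exact hVuniv.image _ (η ⁻¹ᵁ U).ι.continuous.continuousOn
  have hne : ((η ⁻¹ᵁ U : Z'.Opens) : Set Z').Nonempty := by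
    obtain ⟨z, hz⟩ := hUirr.1
    exact ⟨((asIso (η ∣_ U)).inv ⟨z, hz⟩).1, ((asIso (η ∣_ U)).inv ⟨z, hz⟩).2⟩
  have hpre : η.base ⁻¹' ((Z₁ : Set Z) \ W) = ((η ⁻¹ᵁ U : Z'.Opens) : Set Z') := by
    rw [hdiff]; rfl
  rw [hpre]
  exact IsIrreducible.closure ⟨hne, hVirr⟩

/-- **"The strict transform of `Z₁` is a connected component of `Z'`"** (HAL p. 3): for `Z`
reduced locally Noetherian, `Z₁ ∪ W = Z` closed, `Z₁` irreducible and `Z₁ ⊄ W`, and `η` a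
blowing up of `𝓘(Z₁) + 𝓘(W)`, the strict transform `closure η⁻¹(Z₁ ∖ W)` is open, closed and
irreducible, hence it is the connected component of each of its points.
[cite: CossartPiltant2008, Thm 2.1 (proof, HAL p. 3)] -/
theorem strictTransform_eq_connectedComponent [IsReduced Z] [IsLocallyNoetherian Z]
    (Z₁ W : Closeds Z) (hcov : (Z₁ : Set Z) ∪ W = Set.univ) (hirr : IsIrreducible (Z₁ : Set Z))
    (hnot : ¬ (Z₁ : Set Z) ⊆ W) {Z' : Scheme.{u}} {η : Z' ⟶ Z}
    (hη : IsBlowup η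
      (Scheme.IdealSheafData.vanishingIdeal Z₁ ⊔ Scheme.IdealSheafData.vanishingIdeal W)) :
    IsOpen (closure (η.base ⁻¹' ((Z₁ : Set Z) \ W))) ∧
      ∀ x ∈ closure (η.base ⁻¹' ((Z₁ : Set Z) \ W)),
        connectedComponent x = closure (η.base ⁻¹' ((Z₁ : Set Z) \ W)) := by
  obtain ⟨-, -, h₁⟩ := coe_vanishingOpen_eq_closure_preimage Z₁ W hcov hη
  have hopen : IsOpen (closure (η.base ⁻¹' ((Z₁ : Set Z) \ W))) := by
    rw [← h₁]
    exact (vanishingOpen _).2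
  have hconn := (isIrreducible_strictTransform Z₁ W hcov hirr hnot hη).isConnected
  exact ⟨hopen, fun x hx => Set.Subset.antisymm
    (IsClopen.connectedComponent_subset ⟨isClosed_closure, hopen⟩ hx)
    (hconn.isPreconnected.subset_connectedComponent hx)⟩

/-! ## The printed sentence, assembled -/

/-- An irreducible component is not covered by the union of the other components of a
Noetherian space (it would lie in one of them, finitely many closed sets). [folklore] -/
theorem not_subset_sUnion_diff_of_mem_irreducibleComponents {α : Type*} [TopologicalSpace α]
    [NoetherianSpace α] {Z₁ : Set α} (h₁ : Z₁ ∈ irreducibleComponents α) :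
    ¬ Z₁ ⊆ ⋃₀ (irreducibleComponents α \ {Z₁}) := by
  intro hsub
  have hfin : (irreducibleComponents α \ {Z₁}).Finite :=
    Set.Finite.subset NoetherianSpace.finite_irreducibleComponents Set.sdiff_subset
  obtain ⟨C, hC, hZC⟩ := (isIrreducible_iff_sUnion_isClosed.mp h₁.1) (Set.Finite.toFinset hfin)
    (fun C hC => isClosed_of_mem_irreducibleComponents C
      ((Set.Finite.mem_toFinset hfin).mp hC).1)
    (by rwa [Set.Finite.coe_toFinset])
  rw [Set.Finite.mem_toFinset] at hC
  exact hC.2 (Set.Subset.antisymm (h₁.2 hC.1.1 hZC) hZC)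

/-- **Cossart–Piltant 2008, proof of Thm. 2.1, first reduction, as printed** (HAL p. 3): let `Z`
be a reduced Noetherian scheme and `Z₁` one of its irreducible components, `W` the union of the
other irreducible components (a closed set; `Z = Z₁ ∪ W`). There is a blowing up `η : Z' → Z` of
the scheme theoretic intersection `Z₁ ∩ W` (the closed subscheme of `𝓘(Z₁) + 𝓘(W)`); it is
proper and birational, it "induces an isomorphism away from the singular locus of `Z`" (an
isomorphism over every open subset of `Reg Z`), and `Z'` is the disjoint union of the open and
closed strict
transforms `X₁` of `Z₁` and `X₂` of `W`, with `X₁` irreducible — "the strict transform of `Z₁` is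
a connected component of `Z'`". (For `s = 1`, i.e. `W = ∅`, the centre is empty and `η` is an
isomorphism.) [cite: CossartPiltant2008, Thm 2.1 (proof, HAL p. 3)] -/
theorem thm21_first_reduction [IsReduced Z] [IsNoetherian Z] {Z₁ : Set Z}
    (h₁ : Z₁ ∈ irreducibleComponents Z) :
    ∃ (C₁ W : Closeds Z), (C₁ : Set Z) = Z₁ ∧ (W : Set Z) = ⋃₀ (irreducibleComponents Z \ {Z₁}) ∧
      (Z₁ ∪ W = Set.univ) ∧ Z₁ ∩ W ⊆ (Scheme.regularLocus Z)ᶜ ∧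
      ∃ (Z' : Scheme.{u}) (η : Z' ⟶ Z),
        IsBlowup η
          (Scheme.IdealSheafData.vanishingIdeal C₁ ⊔ Scheme.IdealSheafData.vanishingIdeal W) ∧
        IsProper η ∧ IsBirational η ∧
        (∀ U : Z.Opens, (U : Set Z) ⊆ Scheme.regularLocus Z → IsIso (η ∣_ U)) ∧
        ∃ X₁ X₂ : Z'.Opens, X₁ ⊔ X₂ = ⊤ ∧ X₁ ⊓ X₂ = ⊥ ∧
          (X₁ : Set Z') = closure (η.base ⁻¹' (Z₁ \ W)) ∧
          (X₂ : Set Z') = closure (η.base ⁻¹' ((W : Set Z) \ Z₁)) ∧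
          IsIrreducible (X₁ : Set Z') ∧ ∀ x ∈ X₁, connectedComponent x = (X₁ : Set Z') := by
  -- the two closed sets
  have hfin : (irreducibleComponents Z \ {Z₁}).Finite :=
    Set.Finite.subset NoetherianSpace.finite_irreducibleComponents Set.sdiff_subset
  have hWcl : IsClosed (⋃₀ (irreducibleComponents Z \ {Z₁})) := by
    rw [Set.sUnion_eq_biUnion]
    exact Set.Finite.isClosed_biUnion hfin fun C hC => isClosed_of_mem_irreducibleComponents C hC.1
  let C₁ : Closeds Z := ⟨Z₁, isClosed_of_mem_irreducibleComponents Z₁ h₁⟩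
  let W : Closeds Z := ⟨⋃₀ (irreducibleComponents Z \ {Z₁}), hWcl⟩
  have hcov : (C₁ : Set Z) ∪ W = Set.univ := by
    refine Set.eq_univ_iff_forall.mpr fun z => ?_
    by_cases hz : irreducibleComponent z = Z₁
    · exact Or.inl (show z ∈ Z₁ from hz ▸ mem_irreducibleComponent)
    · exact Or.inr ⟨irreducibleComponent z,
        ⟨irreducibleComponent_mem_irreducibleComponents z, hz⟩, mem_irreducibleComponent⟩
  have hW : ∀ z ∈ (W : Set Z), ∃ C ∈ irreducibleComponents Z, C ≠ (C₁ : Set Z) ∧ z ∈ C :=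
    fun z ⟨C, hC, hzC⟩ => ⟨C, hC.1, hC.2, hzC⟩
  have hsing : Z₁ ∩ (W : Set Z) ⊆ (Scheme.regularLocus Z)ᶜ :=
    inter_subset_compl_regularLocus (Z₁ := (C₁ : Set Z)) h₁ hW
  -- blow up `𝓘(Z₁) + 𝓘(W)`
  obtain ⟨Z', η, hη⟩ := Stacks01OG_holds Z
    (Scheme.IdealSheafData.vanishingIdeal C₁ ⊔ Scheme.IdealSheafData.vanishingIdeal W)
  have hprop : IsProper η := Stacks02NS.of_isLocallyNoetherian stacks02NS_holds η _ hη
  obtain ⟨htop, hbot, hX₁⟩ := coe_vanishingOpen_eq_closure_preimage C₁ W hcov hη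
  have hη' : IsBlowup η
      (Scheme.IdealSheafData.vanishingIdeal W ⊔ Scheme.IdealSheafData.vanishingIdeal C₁) := by
    rw [sup_comm]; exact hη
  obtain ⟨-, -, hX₂⟩ :=
    coe_vanishingOpen_eq_closure_preimage W C₁ ((Set.union_comm _ _).trans hcov) hη'
  have hnot : ¬ (C₁ : Set Z) ⊆ W := not_subset_sUnion_diff_of_mem_irreducibleComponents h₁
  have hirr := isIrreducible_strictTransform C₁ W hcov h₁.1 hnot hη
  obtain ⟨-, hcc⟩ := strictTransform_eq_connectedComponent C₁ W hcov h₁.1 hnot hη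
  refine ⟨C₁, W, rfl, rfl, hcov, hsing, Z', η, hη, hprop,
    thm21_blowup_isBirational C₁ W h₁ hW hη,
    fun U hU => thm21_blowup_isIso_of_subset_regularLocus C₁ W h₁ hW hη U hU,
    _, _, htop, hbot, hX₁, hX₂, ?_, fun x hx => ?_⟩
  · rw [hX₁]; exact hirr
  · have hx' : x ∈ ((vanishingOpen ((Scheme.IdealSheafData.vanishingIdeal C₁).comap η) :
        Z'.Opens) : Set Z') := hx
    rw [hX₁] at hx' ⊢
    exact hcc x hx'

end Literature.AlgebraicGeometry.CossartPiltant200819.CP2008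

end
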